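import Literature.Topology.FourManifolds.TautFoliationsLeafTopology
import Mathlib.Topology.UnitInterval
import Mathlib.Topology.Connected.LocallyPathConnected
import HarnessLib

/-!
# Leaf maps and leaf paths of a `C⁰` codimension-one foliation

Sibling of `TautFoliationsLeafTopology.lean` (the leaf topology `M^δ = F.LeafSpace` of a `C⁰`
codimension-one foliation `F : Literature.Topology.FourManifolds.Foliation B M`: plaque maps are open
embeddings `B → M^δ`, the leaves `F.leaf x` are the connected components of `M^δ`). This file
treats maps and paths *into the leaf topology* — the "curves in leaves" and "chains of plaques
along a curve" of the textbooks (Hector–Hirsch, *Introduction to the Geometry of Foliations,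
Part A*, Ch. I 2.2.3–2.2.4 and Ch. II 2.1.6–2.1.8; Camacho–Lins Neto, *Geometric Theory of
Foliations*, Ch. II §1, Ch. IV §1: the holonomy of a leaf is defined along paths in the leaf
covered by chains of plaques) — with complete proofs:

* **Leaf maps** (`continuous_toLeafSpace_comp_iff`): a map `g : X → M` is continuous into
  `M^δ` iff it is continuous into `M` and *tangential*: near every point, the transverse
  coordinate (height) of `g` in a flow box is constant (`eventually_mem_plaque_of_continuous`);
  tangency may be checked in one flow box around each point
  (`continuous_toLeafSpace_comp_of_exists`), so it is independent of the box.
* **A connected leaf map lands in one leaf** (`mem_leaf_of_continuous_toLeafSpace`: leaves are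
  open and closed in `M^δ`).
* **Chains of plaques along leaf paths and leaf homotopies** (`exists_subdivision_forall_mem_plaque`,
  `exists_subdivision_prod_forall_mem_plaque`): a path `[0, 1] → M^δ`, resp. a map
  `[0, 1]² → M^δ`, admits a finite subdivision of `[0, 1]` into intervals, resp. of `[0, 1]²`
  into squares of a uniform grid, each mapped into a single plaque of a flow box of the atlas
  (Lebesgue number; Hector–Hirsch A, Ch. I 2.2.3, proof; Camacho–Lins Neto, Ch. IV §1, the
  chain of plaques subordinated to a path). This is the input of the definition of holonomy.
* **Leaves are path connected, locally path connected, second countable manifolds in their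
  leaf topology** (`Leaf.instPathConnectedSpace`, `Leaf.instSecondCountableTopology`; Hector–Hirsch
  A, Ch. II 2.1.8 (iv): "every leaf of a foliation has a countable basis"; the proof is that of
  Ch. I 2.2.4 — a leaf is a countable union of plaques, `countable_leafHeights` of
  `TautFoliationsLeafHeights.lean`), so that any two points of a leaf are joined by a leaf path
  (`exists_path_of_mem_leaf`) — the form in which "joined by a chain of plaques" is used.

## References

* G. Hector, U. Hirsch, *Introduction to the Geometry of Foliations, Part A*, 2nd ed., Vieweg
  (1986), Ch. I 2.2.3, 2.2.4; Ch. II 2.1.6, 2.1.8 [HectorHirsch1986].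
* C. Camacho, A. Lins Neto, *Geometric Theory of Foliations*, Birkhäuser (1985), Ch. II §1,
  Ch. IV §1 [CamachoLinsNeto1985].
* A. Candel, L. Conlon, *Foliations I*, Grad. Stud. Math. 23, AMS (2000), §1.2, §2.3
  [CandelConlon2000].

## Design notes

* A *leaf map* is simply a continuous map into `F.LeafSpace`; for maps given into `M` the
  criterion `continuous_toLeafSpace_comp_iff` is used. Paths in leaves are `Path`s or
  `C(I, F.LeafSpace)`; subdivisions are produced by Mathlib's
  `exists_monotone_Icc_subset_open_cover_unitInterval(_prod_self)`.
* General leaf model `B` and space `M`; hypotheses (`Nonempty B`, (pre)connectedness, local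
  path connectedness and second countability of `B`, second countability of `M`) only where
  used.
-/
open scoped Topology unitInterval
open Function Set Filter Topology

namespace Literature.Topology.FourManifolds

namespace Foliation

variable {B : Type*} [TopologicalSpace B] {M : Type*} [TopologicalSpace M]
variable {e e' : OpenPartialHomeomorph M (B × ℝ)} {t : ℝ} {x y z : M}
variable (F : Foliation B M)

-- BODY
/-! ## Leaf maps: continuity into the leaf space -/

section LeafMaps

variable {X : Type*} [TopologicalSpace X] {g : X → M} {a : X}

/-- A map continuous into the leaf space is continuous into `M` (the leaf topology is finer).
[folklore] -/
theorem continuous_of_continuous_toLeafSpace (hg : Continuous (toLeafSpace ∘ g : X → F.LeafSpace)) :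
    Continuous g :=
  F.continuous_ofLeafSpace.comp hg

/-- **A leaf map is tangential**: if `g : X → M` is continuous into the leaf space at `a` and
`e` is a flow box of the atlas around `g a`, then near `a` the map `g` takes values in the
plaque of `e` through `g a` (the plaque is open in `M^δ`). [folklore] -/
theorem eventually_mem_plaque_of_continuousAt
    (hg : ContinuousAt (toLeafSpace ∘ g : X → F.LeafSpace) a) (he : e ∈ F.atlas)
    (ha : g a ∈ e.source) : ∀ᶠ b in 𝓝 a, g b ∈ plaque e (e (g a)).2 := by
  have hmem : (ofLeafSpace ⁻¹' plaque e (e (g a)).2 : Set F.LeafSpace) ∈ 𝓝 ((toLeafSpace ∘ g) a) :=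
    (F.isOpen_preimage_plaque_leafSpace he _).mem_nhds (mem_preimage.2 (mem_plaque_self ha))
  filter_upwards [hg.preimage_mem_nhds hmem] with b hb
  exact hb

/-- A leaf map has locally constant transverse coordinate in every flow box of the atlas.
[folklore] -/
theorem eventually_height_eq_of_continuousAt
    (hg : ContinuousAt (toLeafSpace ∘ g : X → F.LeafSpace) a) (he : e ∈ F.atlas)
    (ha : g a ∈ e.source) : ∀ᶠ b in 𝓝 a, (e (g b)).2 = (e (g a)).2 := by
  filter_upwards [F.eventually_mem_plaque_of_continuousAt hg he ha] with b hb
  exact hb.2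

/-- **Tangential maps are leaf maps** (one flow box suffices): if `g : X → M` is continuous at
`a` and, in some flow box `e ∋ g a` of the atlas, the transverse coordinate of `g` is constant
near `a`, then `g` is continuous into the leaf space at `a` — neighbourhoods of `g a` in `M^δ`
are generated by the images under the plaque map through `g a` of neighbourhoods of its
`B`-coordinate (`mem_nhds_leafSpace_iff`), and near `a` the point `g b` is the image of its own
`B`-coordinate, which depends continuously on `b`. [folklore] -/
theorem continuousAt_toLeafSpace_comp (hg : ContinuousAt g a) (he : e ∈ F.atlas)
    (ha : g a ∈ e.source) (hev : ∀ᶠ b in 𝓝 a, (e (g b)).2 = (e (g a)).2) :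
    ContinuousAt (toLeafSpace ∘ g : X → F.LeafSpace) a := by
  refine Filter.tendsto_def.2 fun s hs ↦ ?_
  have ha' : ofLeafSpace ((toLeafSpace (F := F) ∘ g) a) ∈ e.source := ha
  rw [F.mem_nhds_leafSpace_iff he ha'] at hs
  have hc : ContinuousAt (fun b ↦ (e (g b)).1) a :=
    continuous_fst.continuousAt.comp ((e.continuousAt ha).comp hg)
  have h₂ : ∀ᶠ b in 𝓝 a, g b ∈ e.source := hg.preimage_mem_nhds (e.open_source.mem_nhds ha)
  filter_upwards [hc.preimage_mem_nhds hs, h₂, hev] with b hb₁ hb₂ hb₃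
  have hbp : g b ∈ plaque e (e (g a)).2 := ⟨hb₂, hb₃⟩
  have hb : F.leafPlaqueMap e (e (g a)).2 (e (g b)).1 = toLeafSpace (g b) :=
    congrArg toLeafSpace (plaqueMap_fst_eq hbp)
  have hb₁ : F.leafPlaqueMap e (e (g a)).2 (e (g b)).1 ∈ s := hb₁
  rw [hb] at hb₁
  exact hb₁

/-- **Leaf maps are the continuous tangential maps**: `g : X → M` is continuous into the leaf
space `M^δ` iff it is continuous into `M` and, around every point and in every flow box of the
atlas around its image, its transverse coordinate is locally constant (Hector–Hirsch A, Ch. II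
2.1.6 (iv)–(vi): the leaf topology, maps of foliated manifolds; Camacho–Lins Neto, Ch. II §1:
curves in a leaf are the curves in `M` tangent to the plaques). [folklore] -/
theorem continuous_toLeafSpace_comp_iff :
    Continuous (toLeafSpace ∘ g : X → F.LeafSpace) ↔
      Continuous g ∧ ∀ a, ∀ e ∈ F.atlas, g a ∈ e.source → ∀ᶠ b in 𝓝 a, (e (g b)).2 = (e (g a)).2 := by
  constructor
  · intro hg
    exact ⟨F.continuous_of_continuous_toLeafSpace hg,
      fun a e he ha ↦ F.eventually_height_eq_of_continuousAt hg.continuousAt he ha⟩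
  · rintro ⟨hg, h⟩
    refine continuous_iff_continuousAt.2 fun a ↦ ?_
    obtain ⟨e, he, ha⟩ := F.exists_mem_source (g a)
    exact F.continuousAt_toLeafSpace_comp hg.continuousAt he ha (h a e he ha)

/-- **Tangency may be checked in one flow box around each point** (so it does not depend on
the box): a continuous `g : X → M` whose transverse coordinate is locally constant near each
point in *some* flow box of the atlas is continuous into the leaf space. [folklore] -/
theorem continuous_toLeafSpace_comp_of_exists (hg : Continuous g)
    (h : ∀ a, ∃ e ∈ F.atlas, g a ∈ e.source ∧ ∀ᶠ b in 𝓝 a, (e (g b)).2 = (e (g a)).2) :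
    Continuous (toLeafSpace ∘ g : X → F.LeafSpace) := by
  refine continuous_iff_continuousAt.2 fun a ↦ ?_
  obtain ⟨e, he, ha, hev⟩ := h a
  exact F.continuousAt_toLeafSpace_comp hg.continuousAt he ha hev

/-- A map into a single plaque of the atlas is a leaf map as soon as it is continuous into `M`.
[folklore] -/
theorem continuous_toLeafSpace_comp_of_forall_mem_plaque (hg : Continuous g) (he : e ∈ F.atlas)
    (h : ∀ b, g b ∈ plaque e t) : Continuous (toLeafSpace ∘ g : X → F.LeafSpace) :=
  F.continuous_toLeafSpace_comp_of_exists hg fun a ↦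
    ⟨e, he, (h a).1, Filter.Eventually.of_forall fun b ↦ (h b).2.trans (h a).2.symm⟩

/-- **A connected leaf map lands in a single leaf**: if `X` is preconnected and `g : X → M` is
continuous into the leaf space, then all values of `g` lie on the leaf of any one of them
(leaves are open and closed in `M^δ`, `isClopen_preimage_leaf`). In particular a path in the
leaf topology stays in one leaf (Hector–Hirsch A, Ch. II 2.1.6 (v)). [folklore] -/
theorem mem_leaf_of_continuous_toLeafSpace [PreconnectedSpace X]
    (hg : Continuous (toLeafSpace ∘ g : X → F.LeafSpace)) (a b : X) : g b ∈ F.leaf (g a) := by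
  have hU : IsClopen ((toLeafSpace ∘ g) ⁻¹' (ofLeafSpace ⁻¹' F.leaf (g a) : Set F.LeafSpace)) :=
    (F.isClopen_preimage_leaf (g a)).preimage hg
  rcases isClopen_iff.1 hU with h | h
  · have ha : a ∈ (toLeafSpace ∘ g) ⁻¹' (ofLeafSpace ⁻¹' F.leaf (g a) : Set F.LeafSpace) :=
      F.mem_leaf_self (g a)
    rw [h] at ha
    exact absurd ha (notMem_empty a)
  · have hb : b ∈ (toLeafSpace ∘ g) ⁻¹' (ofLeafSpace ⁻¹' F.leaf (g a) : Set F.LeafSpace) := by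
      rw [h]
      exact mem_univ b
    exact hb

/-- The values of a connected leaf map all have the same leaf. [folklore] -/
theorem leaf_eq_of_continuous_toLeafSpace [PreconnectedSpace X]
    (hg : Continuous (toLeafSpace ∘ g : X → F.LeafSpace)) (a b : X) : F.leaf (g b) = F.leaf (g a) :=
  leaf_eq_of_mem (F.mem_leaf_of_continuous_toLeafSpace hg a b)

end LeafMaps

/-! ## Paths in the leaf space -/

section Paths

/-- A path in the leaf space stays in the leaf of its starting point. [folklore] -/
theorem mem_leaf_of_path {p q : F.LeafSpace} (γ : Path p q) (s : I) :
    ofLeafSpace (γ s) ∈ F.leaf (ofLeafSpace p) := by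
  have h := F.mem_leaf_of_continuous_toLeafSpace (g := fun s ↦ ofLeafSpace (γ s))
    (by simpa only [Function.comp_def, toLeafSpace_ofLeafSpace] using γ.continuous) 0 s
  simpa only [γ.source] using h

/-- Points of the leaf space joined by a path lie on the same leaf. [folklore] -/
theorem mem_leaf_of_joined {p q : F.LeafSpace} (h : Joined p q) : ofLeafSpace q ∈ F.leaf (ofLeafSpace p) := by
  obtain ⟨γ⟩ := h
  simpa only [γ.target] using F.mem_leaf_of_path γ 1

/-- **Chain of plaques along a leaf path.** A continuous map `γ : [0, 1] → M^δ` admits a finite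
subdivision `0 = t₀ ≤ t₁ ≤ ⋯ ≤ tₙ = 1` (written as a monotone sequence `t : ℕ → [0, 1]`,
eventually `1`) such that each `γ [tᵢ, tᵢ₊₁]` lies in a single plaque of a flow box of the
atlas: the preimages of the plaques (open in `M^δ`) cover `[0, 1]`, and the Lebesgue number
lemma applies (Hector–Hirsch A, Ch. I 2.2.3, proof; Camacho–Lins Neto, Ch. IV §1: a chain of
plaques subordinated to a path in a leaf). [cite: HectorHirsch1986, Ch. I 2.2.3] -/
theorem exists_subdivision_forall_mem_plaque (γ : C(I, F.LeafSpace)) :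
    ∃ t : ℕ → I, t 0 = 0 ∧ Monotone t ∧ (∃ n, ∀ m ≥ n, t m = 1) ∧
      ∀ n, ∃ e ∈ F.atlas, ∃ τ : ℝ, ∀ s ∈ Icc (t n) (t (n + 1)), ofLeafSpace (γ s) ∈ plaque e τ := by
  -- the open cover of `[0, 1]` by the preimages of the plaques of the atlas
  let ι := {q : OpenPartialHomeomorph M (B × ℝ) × ℝ // q.1 ∈ F.atlas}
  let c : ι → Set I := fun q ↦ γ ⁻¹' (ofLeafSpace ⁻¹' plaque q.1.1 q.1.2)
  have hc₁ : ∀ i, IsOpen (c i) := fun i ↦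
    (F.isOpen_preimage_plaque_leafSpace i.2 _).preimage γ.continuous
  have hc₂ : univ ⊆ ⋃ i, c i := fun s _ ↦ by
    obtain ⟨e, he, hs⟩ := F.exists_mem_source (ofLeafSpace (γ s))
    exact mem_iUnion.2 ⟨⟨(e, (e (ofLeafSpace (γ s))).2), he⟩, mem_plaque_self hs⟩
  obtain ⟨t, ht₀, htm, htn, htc⟩ := exists_monotone_Icc_subset_open_cover_unitInterval hc₁ hc₂
  refine ⟨t, ht₀, htm, htn, fun n ↦ ?_⟩
  obtain ⟨⟨⟨e, τ⟩, he⟩, hsub⟩ := htc n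
  exact ⟨e, he, τ, fun s hs ↦ hsub hs⟩

/-- **Chains of plaques along a leaf homotopy.** A continuous map `H : [0, 1]² → M^δ` (e.g. a
homotopy of leaf paths) admits a uniform grid `0 = t₀ ≤ ⋯ ≤ tₙ = 1` such that each square
`[tᵢ, tᵢ₊₁] × [tⱼ, tⱼ₊₁]` is mapped into a single plaque of a flow box of the atlas (Lebesgue
number lemma for the cover of `[0, 1]²` by the preimages of the plaques). [folklore] -/
theorem exists_subdivision_prod_forall_mem_plaque (H : C(I × I, F.LeafSpace)) :
    ∃ t : ℕ → I, t 0 = 0 ∧ Monotone t ∧ (∃ n, ∀ m ≥ n, t m = 1) ∧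
      ∀ n m, ∃ e ∈ F.atlas, ∃ τ : ℝ,
        ∀ s ∈ Icc (t n) (t (n + 1)) ×ˢ Icc (t m) (t (m + 1)), ofLeafSpace (H s) ∈ plaque e τ := by
  let ι := {q : OpenPartialHomeomorph M (B × ℝ) × ℝ // q.1 ∈ F.atlas}
  let c : ι → Set (I × I) := fun q ↦ H ⁻¹' (ofLeafSpace ⁻¹' plaque q.1.1 q.1.2)
  have hc₁ : ∀ i, IsOpen (c i) := fun i ↦
    (F.isOpen_preimage_plaque_leafSpace i.2 _).preimage H.continuous
  have hc₂ : univ ⊆ ⋃ i, c i := fun s _ ↦ by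
    obtain ⟨e, he, hs⟩ := F.exists_mem_source (ofLeafSpace (H s))
    exact mem_iUnion.2 ⟨⟨(e, (e (ofLeafSpace (H s))).2), he⟩, mem_plaque_self hs⟩
  obtain ⟨t, ht₀, htm, htn, htc⟩ :=
    exists_monotone_Icc_subset_open_cover_unitInterval_prod_self hc₁ hc₂
  refine ⟨t, ht₀, htm, htn, fun n m ↦ ?_⟩
  obtain ⟨⟨⟨e, τ⟩, he⟩, hsub⟩ := htc n m
  exact ⟨e, he, τ, fun s hs ↦ hsub hs⟩

/-- **Vertical paths in a plaque are leaf paths**: the image under a plaque map of a path in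
the leaf model `B` is a path in the leaf space. [folklore] -/
theorem continuous_leafPlaqueMap_comp {X : Type*} [TopologicalSpace X] (he : e ∈ F.atlas) (t : ℝ)
    {β : X → B} (hβ : Continuous β) : Continuous (fun s ↦ F.leafPlaqueMap e t (β s)) :=
  (F.continuous_leafPlaqueMap he t).comp hβ

end Paths

/-! ## Leaves are path connected, second countable manifolds in the leaf topology -/

section Leaves

/-- `M^δ` is locally path connected when the leaf model is (it is a `B`-charted space).
[folklore] -/
instance instLocallyPathConnectedSpaceLeafSpace [Nonempty B] [LocallyPathConnectedSpace B] :
    LocallyPathConnectedSpace F.LeafSpace :=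
  ChartedSpace.locallyPathConnectedSpace B F.LeafSpace

/-- **Leaves are path connected in the leaf topology** (for a connected, locally path
connected leaf model, e.g. `B = ℝⁿ`): a leaf is a connected open subset of the locally path
connected space `M^δ`. [folklore] -/
theorem isPathConnected_preimage_leaf [Nonempty B] [PreconnectedSpace B] [LocallyPathConnectedSpace B]
    (x : M) : IsPathConnected (ofLeafSpace ⁻¹' F.leaf x : Set F.LeafSpace) :=
  (F.isOpen_preimage_leaf x).isConnected_iff_isPathConnected.1 (F.isConnected_preimage_leaf x)

/-- **Any two points of a leaf are joined by a leaf path** (a path in `M^δ`, which then runs in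
that leaf, `mem_leaf_of_path`): the path form of "joined by a finite chain of plaques"
(Hector–Hirsch A, Ch. I 2.2.3–2.2.4; Camacho–Lins Neto, Ch. II §1). [folklore] -/
theorem exists_path_of_mem_leaf [Nonempty B] [PreconnectedSpace B] [LocallyPathConnectedSpace B]
    (hy : y ∈ F.leaf x) :
    ∃ γ : Path (toLeafSpace x : F.LeafSpace) (toLeafSpace y), ∀ s, ofLeafSpace (γ s) ∈ F.leaf x := by
  have h := (F.isPathConnected_preimage_leaf x).joinedIn (toLeafSpace x) (F.mem_leaf_self x)
    (toLeafSpace y) hy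
  obtain ⟨γ, hγ⟩ := h
  exact ⟨γ, hγ⟩

/-- Two points lie on a common leaf iff they are joined by a path in the leaf space.
[folklore] -/
theorem mem_leaf_iff_joined [Nonempty B] [PreconnectedSpace B] [LocallyPathConnectedSpace B] :
    y ∈ F.leaf x ↔ Joined (toLeafSpace x : F.LeafSpace) (toLeafSpace y) := by
  constructor
  · intro hy
    obtain ⟨γ, -⟩ := F.exists_path_of_mem_leaf hy
    exact ⟨γ⟩
  · intro h
    exact F.mem_leaf_of_joined h

/-- Leaves are path connected spaces in their leaf topology. [folklore] -/
instance Leaf.instPathConnectedSpace [Nonempty B] [PreconnectedSpace B] [LocallyPathConnectedSpace B]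
    (x : M) : PathConnectedSpace (F.Leaf x) :=
  isPathConnected_iff_pathConnectedSpace.1 (F.isPathConnected_preimage_leaf x)

/-- Leaves are locally path connected in their leaf topology. [folklore] -/
instance Leaf.instLocallyPathConnectedSpace [Nonempty B] [LocallyPathConnectedSpace B] (x : M) :
    LocallyPathConnectedSpace (F.Leaf x) :=
  (F.isOpen_preimage_leaf x).locallyPathConnectedSpace

/-- **A plaque of a leaf, in the leaf topology, is homeomorphic to the leaf model**: the plaque
map of `e` at a leaf height `t`, corestricted to the leaf `F.Leaf x`. [folklore] -/
noncomputable def Leaf.plaqueHomeomorph (he : e ∈ F.atlas) (ht : t ∈ F.leafHeights e x) :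
    B ≃ₜ {p : F.Leaf x // ofLeafSpace (p : F.LeafSpace) ∈ plaque e t} where
  toFun b := ⟨Leaf.mk (plaqueMap e t b) (F.plaque_subset_leaf he ht (F.plaqueMap_mem_plaque he t b)),
    F.plaqueMap_mem_plaque he t b⟩
  invFun p := (e (ofLeafSpace ((p : F.Leaf x) : F.LeafSpace))).1
  left_inv b := by simp only [Leaf.ofLeafSpace_coe_mk, F.apply_plaqueMap he]
  right_inv p := by
    obtain ⟨⟨p, hpL⟩, hp⟩ := p
    apply Subtype.ext
    apply Subtype.ext
    exact (ofLeafSpace (F := F)).injective (plaqueMap_fst_eq hp)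
  continuous_toFun := ((F.continuous_leafPlaqueMap he t).subtype_mk _).subtype_mk _
  continuous_invFun := continuous_fst.comp (e.continuousOn.comp_continuous
    ((Leaf.continuous_coe F x).comp continuous_subtype_val) fun p ↦ p.2.1)

/-- **Leaves are second countable in their leaf topology** (Hector–Hirsch A, Ch. II 2.1.8 (iv):
"every leaf of a foliation has a countable basis"; Ch. I 2.2.4 for the proof): for a second
countable `M` and a second countable preconnected leaf model, a leaf is the union of the
plaques `plaque e t`, `e` in a countable subatlas (`exists_countable_subatlas`), `t` in the
countable set of its heights in `e` (`countable_leafHeights`) — countably many open subsets of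
the leaf, each homeomorphic to `B`. [cite: HectorHirsch1986, Ch. II 2.1.8 (iv)] -/
instance Leaf.instSecondCountableTopology [Nonempty B] [PreconnectedSpace B] [SecondCountableTopology B]
    [SecondCountableTopology M] (x : M) : SecondCountableTopology (F.Leaf x) := by
  obtain ⟨A, hA, hAc, hAcov⟩ := F.exists_countable_subatlas
  -- index set: boxes of `A` with a height of the leaf
  let ι := {q : OpenPartialHomeomorph M (B × ℝ) × ℝ // q.1 ∈ A ∧ q.2 ∈ F.leafHeights q.1 x}
  have hι : Countable ι := by
    have hT : {q : OpenPartialHomeomorph M (B × ℝ) × ℝ | q.1 ∈ A ∧ q.2 ∈ F.leafHeights q.1 x}.Countable := by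
      have hsub : {q : OpenPartialHomeomorph M (B × ℝ) × ℝ | q.1 ∈ A ∧ q.2 ∈ F.leafHeights q.1 x} ⊆
          ⋃ e ∈ A, (fun t ↦ (e, t)) '' F.leafHeights e x := by
        rintro ⟨e, t⟩ ⟨he, ht⟩
        exact mem_iUnion₂.2 ⟨e, he, t, ht, rfl⟩
      exact Countable.mono hsub
        (hAc.biUnion fun e he ↦ (F.countable_leafHeights (hA he) x).image _)
    exact hT.to_subtype
  -- the open cover of the leaf by these plaques
  let U : ι → Set (F.Leaf x) := fun q ↦ {p | ofLeafSpace (p : F.LeafSpace) ∈ plaque q.1.1 q.1.2}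
  have hUo : ∀ q, IsOpen (U q) := fun q ↦
    (F.isOpen_preimage_plaque_leafSpace (hA q.2.1) q.1.2).preimage continuous_subtype_val
  have hUc : ⋃ q, U q = univ := by
    refine eq_univ_of_forall fun p ↦ ?_
    obtain ⟨e, he, hpe⟩ := hAcov (ofLeafSpace (p : F.LeafSpace))
    have ht : (e (ofLeafSpace (p : F.LeafSpace))).2 ∈ F.leafHeights e x :=
      F.height_mem_leafHeights p.2 hpe
    exact mem_iUnion.2 ⟨⟨(e, _), he, ht⟩, mem_plaque_self hpe⟩
  have hU2 : ∀ q, SecondCountableTopology (U q) := fun q ↦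
    (Leaf.plaqueHomeomorph F (hA q.2.1) q.2.2).symm.secondCountableTopology
  exact TopologicalSpace.secondCountableTopology_of_countable_cover hUo hUc

end Leaves

end Foliation

end Literature.Topology.FourManifolds
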